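import Summits.ValiantsHypothesis.ValiantsHypothesis.Theorems.LangWeilTransferTameResolutionGenericModel
import Summits.ValiantsHypothesis.ValiantsHypothesis.Theorems.LangWeilTransferTameResolutionQSizes
import Summits.ValiantsHypothesis.ValiantsHypothesis.Theorems.LangWeilTransferTameResolutionResSizes
import Summits.ValiantsHypothesis.ValiantsHypothesis.Theorems.LangWeilTransferTameResolutionVRhoSizes
import Summits.ValiantsHypothesis.ValiantsHypothesis.Theorems.LangWeilTransferTameResolutionQFinalSizes
import Summits.ValiantsHypothesis.ValiantsHypothesis.Theorems.LangWeilTransferTameResolutionEnvelope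

/-!
# LangWeilTransfer — congruence models with single-exponential sizes (the quantitative half of
# `TameResolution`, stmt-ValiantsHypothesis-6378)

Route `LangWeilTransfer` of `ValiantsHypothesis`. Final assembly of the quantitative Kronecker
parametrisation along the NOETHER-FREE line (val-width-6373-p2 g2):

1. `exists_generic_model` (…GenericModel): for an integer system `S` and a minimal prime `𝔭` of
   `(S) ⊂ ℚ[Y]`, a transcendence basis AMONG the coordinates (…CoordinateBasis), the integer
   Kronecker parametrisation over it WITHOUT Noether position (val-lit-p6 g9's eliminant pipeline,
   hint-free: `exists_parametrisation_generic'`), made monic by `integralNormalization`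
   (…Normalize), read as a congruence model with all data exported;
2. the size chain of val-lit-p6 g9 on that data (`q_sizes` → `res_B_sizes` → `rho_sizes`,
   `V_sizes` → `Q_sizes`) and this line's normalisation sizes, flattened (`…FlatSizes`);
3. the envelope read-out (…Envelope: every degree is `≤ B^i`, every weight `≤ 2^(B^i L)` with
   `B = (d+2)^(m+1)`, `L = log₂ w + log₂ t + 2`, for explicit numerals `i ≤ 512`);
4. the result is exactly the hypothesis of val-width-6373-p2 g0's `tameResolution_of_congruenceModels`
   (…TameResolutionOfCongruences), which turns it into `TameResolution` and Theorem T
   (`…LangWeilTransferTameTransfer`). This file imports no route (`Theses`) file.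

* `congruenceModels_holds` — the hypothesis of `tameResolution_of_congruenceModels`, `a = 512`.

Honest framing: `TameResolution` is an unconditional theorem of effective commutative algebra
(a Kronecker parametrisation of a ℚ-component with single-exponential degree and height); the
ROUTE to `ValiantsHypothesis` stays conditional on its open cruxes (ShatteringExclusion /
UniversalTameness and P^#P ⊄ P/poly). VP ≠ VNP is NOT proved here.
-/

noncomputable section

open MvPolynomial
open Literature.RingTheory.Elimination
open Literature.Computability.AlgebraicComplexity (weight)

-- the summit and the problem share the name `ValiantsHypothesis` (D-0017 single-conjunct layout)
set_option linter.dupNamespace false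

namespace Summit.ValiantsHypothesis.ValiantsHypothesis.Theorems.LangWeilTransfer

open Envelope

/-- Degree read-out with the base kept abstract (avoids numeral-exponent evaluation during
unification). -/
theorem final_degree_base {Bb d m a x i : ℕ} (hBb : Bb = (d + 2) ^ (m + 1)) (hx : x ≤ Bb ^ i) (hi : i ≤ a) :
    x ≤ (d + 2) ^ (a * (m + 1)) := by
  subst hBb; exact final_degree hx hi

/-- Weight read-out with the base kept abstract. -/
theorem final_weight_base {Bb L d m a x i : ℕ} (hBb : Bb = (d + 2) ^ (m + 1)) (hx : x ≤ 2 ^ (Bb ^ i * L))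
    (hi : i ≤ a) (ha : 1 ≤ a) (hL : 1 ≤ L) : Nat.log 2 x ≤ (d + 2) ^ (a * (m + 1)) * L ^ a := by
  subst hBb; exact final_weight hx hi ha hL

/-- **Congruence models with single-exponential sizes exist** (the hypothesis of
`tameResolution_of_congruenceModels`, exponent `a = 512`). -/
theorem congruenceModels_holds : ∃ a : ℕ, ∀ (m t d w : ℕ) (S : Fin t → MvPolynomial (Fin m) ℤ),
      (∀ i, (S i).totalDegree ≤ d) → (∀ i, weight (S i) ≤ w) →
      ∀ 𝔭 ∈ (Ideal.span (Set.range fun i => MvPolynomial.map (Int.castRingHom ℚ) (S i))).minimalPrimes,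
      ∃ (r : ℕ) (ℓ : Fin r → MvPolynomial (Fin m) ℚ) (u : MvPolynomial (Fin m) ℚ)
        (Q : MvPolynomial (Fin (r + 1)) ℤ) (ρ : MvPolynomial (Fin r) ℤ)
        (V : Fin m → MvPolynomial (Fin (r + 1)) ℤ) (cQ : ℤ),
        r ≤ m ∧ cQ ≠ 0 ∧ ρ ≠ 0 ∧ (MvPolynomial.finSuccEquiv ℤ r Q).leadingCoeff = MvPolynomial.C cQ ∧
        0 < (MvPolynomial.finSuccEquiv ℤ r Q).natDegree ∧
        Irreducible (MvPolynomial.map (Int.castRingHom ℚ) Q) ∧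
        AlgebraicIndependent ℚ (fun i => Ideal.Quotient.mk 𝔭 (ℓ i)) ∧
        MvPolynomial.aeval (Fin.cons u ℓ : Fin (r + 1) → MvPolynomial (Fin m) ℚ)
          (MvPolynomial.map (Int.castRingHom ℚ) Q) ∈ 𝔭 ∧
        (∀ j, MvPolynomial.aeval ℓ (MvPolynomial.map (Int.castRingHom ℚ) ρ) * X j -
          MvPolynomial.aeval (Fin.cons u ℓ : Fin (r + 1) → MvPolynomial (Fin m) ℚ)
            (MvPolynomial.map (Int.castRingHom ℚ) (V j)) ∈ 𝔭) ∧
        Q.totalDegree ≤ (d + 2) ^ (a * (m + 1)) ∧ ρ.totalDegree ≤ (d + 2) ^ (a * (m + 1)) ∧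
        (∀ j, (V j).totalDegree ≤ (d + 2) ^ (a * (m + 1))) ∧
        Nat.log 2 (weight Q) ≤ (d + 2) ^ (a * (m + 1)) * (Nat.log 2 w + Nat.log 2 t + 2) ^ a ∧
        Nat.log 2 (weight ρ) ≤ (d + 2) ^ (a * (m + 1)) * (Nat.log 2 w + Nat.log 2 t + 2) ^ a ∧
        ∀ j, Nat.log 2 (weight (V j)) ≤
          (d + 2) ^ (a * (m + 1)) * (Nat.log 2 w + Nat.log 2 t + 2) ^ a := by
  classical
  refine ⟨512, fun m t d w S hSd hSw 𝔭 h𝔭 => ?_⟩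
  obtain ⟨r, n, e, S', a, q, B, c, Q, hgm⟩ := exists_generic_model S hSd 𝔭 h𝔭
  extract_lets ι F uU 𝒬 σa Res sp dq ρ V κ M Qn ρn Vn ℓ uP at hgm
  obtain ⟨hnr, hS'd, hS'c, hS'w, haN, hqirr, hqdeg, h𝒬a0, hq𝒬, hBdeg, hBcoeff, hcN, hqc0, hQdvd, hρ0, hQdeg,
    hlc, hdegQn, hirrQn, hind, hroot, hcong⟩ := hgm
  have hN1 : 1 ≤ (d + 1) ^ n := Nat.one_le_pow _ _ (by omega)
  have hQ0 : Q ≠ 0 := fun h => by rw [h, Polynomial.natDegree_zero] at hQdeg; exact lt_irrefl 0 hQdeg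
  have hκ0 : κ ≠ 0 := Polynomial.leadingCoeff_ne_zero.2 hQ0
  have hρn0 : ρn ≠ 0 := mul_ne_zero hρ0 (pow_ne_zero _ hκ0)
  -- (S1) `a ≤ D + 1`
  have haD : ∀ p, a p ≤ (d + 1) ^ n * (1 + (1 + n * d + 1) * (d + 1)) + 1 := by
    intro p
    refine (haN p).trans ((Finset.sup_le fun k _ => ?_).trans (Nat.le_succ _))
    have h := totalDegree_coeff_universalEliminant_le (d := d) S' hS'c (1 + n * d + 1) k
    exact h
  -- (S2) sizes of `q`
  have hq := q_sizes (d := d) S' hS'c (fun k => (hS'w k).trans (hSw k)) a (Na := _ ) (by omega) haD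
    (1 + n * d + 1) q h𝒬a0 hq𝒬
  obtain ⟨hqN, hqD, hqW⟩ := hq
  -- (S3) sizes of `Res`, `B`, `c`
  have hRB := res_B_sizes q B hN1 (Nat.one_le_iff_ne_zero.2 (by positivity)) hqN hqD hqW hBcoeff c hcN
  obtain ⟨hResW, hResD, hBW, hBD, hcNc⟩ := hRB
  have hc' : ∀ j, c j ≤ _ + 1 := fun j => (hcNc j).trans (Nat.le_succ _)
  -- (S4) sizes of `ρ`
  have hρsz := rho_sizes (r := r) c (by omega) hc' Res hResD hResW
  obtain ⟨hρD, hρW⟩ := hρsz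
  -- (S5) sizes of the numerators `V_j` (flat)
  have hBN : B.natDegree ≤ (d + 1) ^ n :=
    (Polynomial.natDegree_le_iff_degree_le.2 (hBdeg.le.trans (by exact_mod_cast hqN)))
  have hflatq_deg := totalDegree_finSuccEquiv_symm_le
    (q.map ((rename finSumFinEquiv : MvPolynomial (Fin n ⊕ Fin r) ℤ →ₐ[ℤ] MvPolynomial (Fin (n + r)) ℤ).toRingHom.comp
      (sumAlgEquiv ℤ (Fin n) (Fin r)).symm.toRingEquiv.toRingHom))
    (Polynomial.natDegree_map_le.trans hqN) (fun i => by rw [Polynomial.coeff_map]; exact hqD i)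
  have hflatq_wt := weight_finSuccEquiv_symm_le
    (q.map ((rename finSumFinEquiv : MvPolynomial (Fin n ⊕ Fin r) ℤ →ₐ[ℤ] MvPolynomial (Fin (n + r)) ℤ).toRingHom.comp
      (sumAlgEquiv ℤ (Fin n) (Fin r)).symm.toRingEquiv.toRingHom))
    (Polynomial.natDegree_map_le.trans hqN) (fun i => by rw [Polynomial.coeff_map]; exact hqW i)
  have hflatB_deg := totalDegree_finSuccEquiv_symm_le
    (B.map ((rename finSumFinEquiv : MvPolynomial (Fin n ⊕ Fin r) ℤ →ₐ[ℤ] MvPolynomial (Fin (n + r)) ℤ).toRingHom.comp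
      (sumAlgEquiv ℤ (Fin n) (Fin r)).symm.toRingEquiv.toRingHom))
    (Polynomial.natDegree_map_le.trans hBN) (fun i => by rw [Polynomial.coeff_map]; exact hBD i)
  have hflatB_wt := weight_finSuccEquiv_symm_le
    (B.map ((rename finSumFinEquiv : MvPolynomial (Fin n ⊕ Fin r) ℤ →ₐ[ℤ] MvPolynomial (Fin (n + r)) ℤ).toRingHom.comp
      (sumAlgEquiv ℤ (Fin n) (Fin r)).symm.toRingEquiv.toRingHom))
    (Polynomial.natDegree_map_le.trans hBN) (fun i => by rw [Polynomial.coeff_map]; exact hBW i)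
  have hVsz : ∀ j, _ := fun j =>
    V_sizes (r := r) c (by omega) hc' q B j hflatq_deg hflatq_wt hflatB_deg hflatB_wt
  -- (S6) sizes of `Q`
  have hQsz := Q_sizes (r := r) c (by omega) hc' q Q hqN hqD hqW hqc0 hQdvd
  obtain ⟨hQN, hQD, hQW⟩ := hQsz
  have hQcD : ∀ i, (Q.coeff i).totalDegree ≤ _ := fun i => (totalDegree_coeff_le_flat Q i).trans hQD
  have hQcW : ∀ i, weight (Q.coeff i) ≤ _ + 1 := fun i => ((weight_coeff_le_flat Q i).trans hQW).trans (Nat.le_succ _)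
  have hκD : κ.totalDegree ≤ _ := hQcD Q.natDegree
  have hκW : weight κ ≤ _ := hQcW Q.natDegree
  -- (S7) sizes of the normalised data
  have hQn_c : ∀ i, _ := fun i =>
    integralNormalization_coeff_sizes Q hQN hN1 hQcD (by omega) hQcW i
  have hQnN : (Polynomial.integralNormalization Q).natDegree ≤ (d + 1) ^ n :=
    (Polynomial.natDegree_integralNormalization).trans_le hQN
  have hQnD := totalDegree_finSuccEquiv_symm_le (Polynomial.integralNormalization Q) hQnN (fun i => (hQn_c i).1)
  have hQnW := weight_finSuccEquiv_symm_le (Polynomial.integralNormalization Q) hQnN (fun i => (hQn_c i).2)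
  have hM : M ≤ _ := Finset.sup_le fun j _ => (natDegree_le_totalDegree_flat (V j)).trans (hVsz j).1
  have hρn := rho_mul_pow_sizes (M := M) κ ρ hκD hρD hκW hρW
  have hVc_D : ∀ j i, ((V j).coeff i).totalDegree ≤ _ := fun j i =>
    (totalDegree_coeff_le_flat (V j) i).trans (hVsz j).1
  have hVc_W : ∀ j i, weight ((V j).coeff i) ≤ _ := fun j i => (weight_coeff_le_flat (V j) i).trans (hVsz j).2
  have hMj : ∀ j, (V j).natDegree ≤ M := fun j =>
    Finset.le_sup (f := fun j => (V j).natDegree) (Finset.mem_univ j)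
  have hVn_c : ∀ j i, _ := fun j i =>
    scaleRoots_coeff_sizes κ (V j) (hMj j) hκD (hVc_D j) (by omega) hκW (hVc_W j) i
  have hVnD : ∀ j, _ := fun j => totalDegree_finSuccEquiv_symm_le
    (Polynomial.C (κ ^ (M - (V j).natDegree)) * (V j).scaleRoots κ)
    (natDegree_C_mul_scaleRoots_le κ (V j) (hMj j)) (fun i => (hVn_c j i).1)
  have hVnW : ∀ j, _ := fun j => weight_finSuccEquiv_symm_le
    (Polynomial.C (κ ^ (M - (V j).natDegree)) * (V j).scaleRoots κ)
    (natDegree_C_mul_scaleRoots_le κ (V j) (hMj j)) (fun i => (hVn_c j i).2)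
  -- base coordinates: `Vn (e (inr k)) = rename succ (ρn * X k)`
  have hVbD : ∀ k, ((finSuccEquiv ℤ r).symm (Polynomial.C (ρn * X k))).totalDegree ≤ ρn.totalDegree + 1 := by
    intro k
    rw [finSuccEquiv_symm_C]
    refine (totalDegree_rename_le _ _).trans ((totalDegree_mul _ _).trans (Nat.add_le_add_left ?_ _))
    exact (totalDegree_X (R := ℤ) k).le
  have hVbW : ∀ k, weight ((finSuccEquiv ℤ r).symm (Polynomial.C (ρn * X k))) ≤ weight ρn := by
    intro k
    rw [finSuccEquiv_symm_C, Literature.Computability.AlgebraicComplexity.weight_rename_of_injective (Fin.succ_injective _)]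
    refine (Literature.Computability.AlgebraicComplexity.weight_mul_le _ _).trans ?_
    rw [Literature.Computability.AlgebraicComplexity.weight_X, mul_one]
  have hVn_eq : ∀ j, Vn (e (Sum.inl j)) =
      (finSuccEquiv ℤ r).symm (Polynomial.C (κ ^ (M - (V j).natDegree)) * (V j).scaleRoots κ) := fun j => by
    simp only [Vn, Equiv.symm_apply_apply, Sum.elim_inl]
  have hVb_eq : ∀ k, Vn (e (Sum.inr k)) = (finSuccEquiv ℤ r).symm (Polynomial.C (ρn * X k)) := fun k => by
    simp only [Vn, Equiv.symm_apply_apply, Sum.elim_inr]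
  /- ENVELOPE: abbreviate the closed forms -/
  set N := (d + 1) ^ n with hN
  set K := 1 + n * d + 1 with hK
  set D := N * (1 + K * (d + 1)) with hD
  set Dp := D + N with hDp
  set W := (1 + (1 + t * w) ^ K * n) ^ N * (D + 1) ^ D with hW
  set Φ := (Dp + 1) * (2 * Dp + 1) ^ (2 * Dp) with hΦ
  set Wp := (N + 1) * W * Φ ^ (n + r + 1) with hWp
  set WR := (2 * N).factorial * (N * Wp) ^ (2 * N) with hWR
  set DR := 2 * N * Dp with hDR
  set Nc := DR + Dp with hNc
  set Dq := Dp + N with hDq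
  set DB := DR + N with hDB
  set Φ' := (Dq + 1) * (2 * Dq + 1) ^ (2 * Dq) with hΦ'
  set WQ := (N + 1) * ((N + 1) * (Wp * (Nc + 1) ^ Dp) * Φ' ^ (r + 1)) with hWQ
  set DQ := Dq + N with hDQ
  set DV := Dq + DB with hDV
  set WV := Dq * ((N + 1) * Wp) * ((N + 1) * WR) * (Nc + 1) ^ (Dq + DB) with hWV
  -- the two currencies
  set Bb := (d + 2) ^ (m + 1) with hBb
  set L := Nat.log 2 w + Nat.log 2 t + 2 with hL
  have hB : 2 ≤ Bb := two_le_base d m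
  have hL1 : 1 ≤ L := by omega
  -- degree currency
  have e0 : 1 ≤ Bb ^ 0 := by rw [pow_zero]
  have e2 : 2 ≤ Bb ^ 2 := self_le_pow hB 2
  have ed1 : d + 1 ≤ Bb ^ 1 := succ_le_base d m
  have ed : d ≤ Bb ^ 1 := (Nat.le_succ d).trans ed1
  have en : n ≤ Bb ^ 1 := le_base_of_le (by omega)
  have er1 : r + 1 ≤ Bb ^ 1 := le_base_of_le (by omega)
  have enr1 : n + r + 1 ≤ Bb ^ 1 := le_base_of_le (by omega)
  have eN : N ≤ Bb ^ 1 := pow_le_base (by omega)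
  have eN1 := dadd hB eN e0
  have eK : K ≤ _ := dadd hB (dadd hB e0 (dmul en ed)) e0
  have eD : D ≤ _ := dmul eN (dadd hB e0 (dmul eK ed1))
  have eD1 := dadd hB eD e0
  have eDp : Dp ≤ _ := dadd hB eD eN
  have e2N : 2 * N ≤ _ := dmul e2 eN
  have eDR : DR ≤ _ := dmul e2N eDp
  have eNc : Nc ≤ _ := dadd hB eDR eDp
  have eNc1 := dadd hB eNc e0
  have eDq : Dq ≤ _ := dadd hB eDp eN
  have eDB : DB ≤ _ := dadd hB eDR eN
  have eDV : DV ≤ _ := dadd hB eDq eDB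
  have eDQ : DQ ≤ _ := dadd hB eDq eN
  have eM := hM.trans eDV
  have eDp1 := dadd hB eDp e0
  have e2Dp : 2 * Dp ≤ _ := dmul e2 eDp
  have e2Dp1 := dadd hB e2Dp e0
  have eDq1 := dadd hB eDq e0
  have e2Dq : 2 * Dq ≤ _ := dmul e2 eDq
  have e2Dq1 := dadd hB e2Dq e0
  have eM1 := dadd hB eM e0
  -- final degrees
  have fQn := dadd hB (dmul eN eDQ) eN
  have fρn := (hρn.1).trans (dadd hB eDR (dmul eM eDQ))
  have fVn : ∀ j, _ := fun j => (hVnD j).trans (dadd hB (dadd hB eDV (dmul eM eDQ)) eM)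
  have fVb : ∀ k, _ := fun k => (hVbD k).trans (dadd hB fρn e0)
  -- weight currency
  have ww : w ≤ 2 ^ (Bb ^ 0 * L) := w_le w t
  have wt : t ≤ 2 ^ (Bb ^ 0 * L) := t_le w t
  have u_1tw := wadd hB hL1 (wone (B := Bb) (L := L) (i := 0)) (wmul hB wt ww)
  have u_in := wadd hB hL1 (wone (B := Bb) (L := L) (i := 0)) (wmul hB (wpow u_1tw eK) (wofd hL1 en))
  have uW : W ≤ _ := wmul hB (wpow u_in eN) (wpow (wofd hL1 eD1) eD)
  have uΦ : Φ ≤ _ := wmul hB (wofd hL1 eDp1) (wpow (wofd hL1 e2Dp1) e2Dp)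
  have uWp : Wp ≤ _ := wmul hB (wmul hB (wofd hL1 eN1) uW) (wpow uΦ enr1)
  have uWR : WR ≤ _ := wmul hB (wfact hL1 e2N) (wpow (wmul hB (wofd hL1 eN) uWp) e2N)
  have uρB : WR * (Nc + 1) ^ DR ≤ _ := wmul hB uWR (wpow (wofd hL1 eNc1) eDR)
  have uWq : (N + 1) * Wp ≤ _ := wmul hB (wofd hL1 eN1) uWp
  have uWB : (N + 1) * WR ≤ _ := wmul hB (wofd hL1 eN1) uWR
  have uWV : WV ≤ _ := wmul hB (wmul hB (wmul hB (wofd hL1 eDq) uWq) uWB) (wpow (wofd hL1 eNc1) (dadd hB eDq eDB))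
  have uΦ' : Φ' ≤ _ := wmul hB (wofd hL1 eDq1) (wpow (wofd hL1 e2Dq1) e2Dq)
  have uWQ : WQ ≤ _ := wmul hB (wofd hL1 eN1)
    (wmul hB (wmul hB (wofd hL1 eN1) (wmul hB uWp (wpow (wofd hL1 eNc1) eDp))) (wpow uΦ' er1))
  have uWQ1 := wadd hB hL1 uWQ (wone (B := Bb) (L := L) (i := 0))
  -- final weights
  have gQn := hQnW.trans (wmul hB (wofd hL1 eN1) (wpow uWQ1 eN))
  have gρn := (hρn.2).trans (wmul hB uρB (wpow uWQ1 eM))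
  have gVn : ∀ j, _ := fun j => (hVnW j).trans (wmul hB (wofd hL1 eM1) (wmul hB uWV (wpow uWQ1 eM)))
  have gVb : ∀ k, _ := fun k => (hVbW k).trans gρn
  -- the model
  refine ⟨r, ℓ, uP, Qn, ρn, Vn, 1, by omega, one_ne_zero, hρn0, hlc, hdegQn, hirrQn, hind, hroot, hcong,
    final_degree_base hBb (hQnD.trans fQn) (by norm_num), final_degree_base hBb fρn (by norm_num), ?_,
    final_weight_base hBb gQn (by norm_num) (by norm_num) hL1,
    final_weight_base hBb gρn (by norm_num) (by norm_num) hL1, ?_⟩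
  · intro i
    obtain ⟨v, rfl⟩ := e.surjective i
    rcases v with j | k
    · rw [hVn_eq]; exact final_degree_base hBb (fVn j) (by norm_num)
    · rw [hVb_eq]; exact final_degree_base hBb (fVb k) (by norm_num)
  · intro i
    obtain ⟨v, rfl⟩ := e.surjective i
    rcases v with j | k
    · rw [hVn_eq]; exact final_weight_base hBb (gVn j) (by norm_num) (by norm_num) hL1
    · rw [hVb_eq]; exact final_weight_base hBb (gVb k) (by norm_num) (by norm_num) hL1


end Summit.ValiantsHypothesis.ValiantsHypothesis.Theorems.LangWeilTransfer

end
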